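import Summits.SmoothPoincare4.SmoothPoincare4.Theorems.CylinderEntropyCylinderRungTwoTiltExcessVanishing
import Literature.Geometry.Lorentzian.VolumePositivity
import Mathlib.MeasureTheory.Measure.OpenPos
import HarnessLib

/-!
# Route `CylinderEntropy`, crux `CylinderRungTwo` (stmt-SmoothPoincare4-7631), line `killing-flux`:
# HORIZONTALITY FROM VANISHING TILT EXCESS (rigidity layer R1-D,
# registered helper `helper_horizontalOfTiltExcessZero`)

For a closed immersed cross-section `f : M⁴ → ℝ⁶` (`hf : IsSpacelikeImmersion`, `g = f^*δ` the
induced Riemannian metric, `μ_g = riemannianMeasure g`) with a continuous unit normal `ν`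
(`‖ν‖ = 1`, so `0 ≤ 1 - ν₅²`, `one_sub_sq_apply_five_nonneg`), the vanishing of the TILT EXCESS
forces horizontality everywhere:

  `∫_M (1 - ν₅²) dμ_g = 0  ⟹  ν₅(x)² = 1` for every `x ∈ M`.

Proof: the integrand `F = 1 - ν₅²` is continuous, nonnegative and integrable on the compact `M`
(`integrable_of_continuous`, the Riemannian measure of a closed manifold is finite), so
`∫ F dμ_g = 0` gives `F = 0` `μ_g`-a.e. (Mathlib's `integral_eq_zero_iff_of_nonneg`); the Riemannian
measure charges every nonempty open set (`isOpenPosMeasure_riemannianMeasure`, Federer 1969,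
§3.2.46), hence a continuous function vanishing a.e. vanishes identically
(Mathlib's `Continuous.ae_eq_iff_eq`). If `M = ∅` the conclusion is vacuous; no case distinction is
needed.

* `one_sub_sq_apply_five_eq_zero_of_tiltExcess_eq_zero` — the statement with implicit binders,
  conclusion `1 - ν₅(x)² = 0`;
* `helper_horizontalOfTiltExcessZero` — the registered helper, verbatim.

Everything here is PROVED (no `sorry`, no new definitions, no named facts).

References: R. S. Hamilton, Comm. Anal. Geom. 1 (1993) 127–137, §4 (horizontal slices of
`S⁴ × ℝ`); H. Federer, *Geometric Measure Theory* (1969), §3.2.46 (the Riemannian measure is a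
positive smooth density in charts).
-/

-- the prescribed namespace `Summit.SmoothPoincare4.SmoothPoincare4.…` repeats `SmoothPoincare4`
set_option linter.dupNamespace false

noncomputable section

open Set Function Filter MeasureTheory
open scoped Manifold ContDiff Topology

namespace Summit.SmoothPoincare4.SmoothPoincare4.Cruxes.CylinderRungTwo.KillingFlux

open Literature.Geometry.Riemannian Literature.Geometry.Lorentzian
  Literature.Geometry.Lorentzian.PseudoRiemannianMetric

/-- **Vanishing tilt excess forces pointwise horizontality.** For a closed immersed cross-section
`f : M⁴ → ℝ⁶` with continuous unit normal `ν` and `g = f^*δ`: if `∫_M (1 - ν₅²) dμ_g = 0` then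
`1 - ν₅(x)² = 0` for every `x` (the integrand is continuous and nonnegative, the Riemannian measure
is finite and positive on nonempty open sets). [cite: Federer1969, §3.2.46] -/
theorem one_sub_sq_apply_five_eq_zero_of_tiltExcess_eq_zero {M : Type*} [TopologicalSpace M]
    [ChartedSpace (EuclideanSpace ℝ (Fin 4)) M] [IsManifold (𝓡 4) ∞ M] [CompactSpace M]
    [T2Space M] [MeasurableSpace M] [BorelSpace M] {f νf : M → EuclideanSpace ℝ (Fin 6)}
    (hf : (euclideanMetric (EuclideanSpace ℝ (Fin 6))).IsSpacelikeImmersion (𝓡 4) f)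
    (hνc : Continuous νf)
    (hun : (euclideanMetric (EuclideanSpace ℝ (Fin 6))).IsUnitNormal (𝓡 4) f νf 1)
    (h0 : ∫ w, (1 - νf w 5 ^ 2) ∂riemannianMeasure ((euclideanMetric (EuclideanSpace ℝ (Fin 6))).inducedRiemannianMetric f
        contMDiff_pullbackBilin_holds hf) = 0)
    (x : M) : 1 - νf x 5 ^ 2 = 0 := by
  set g₁ := (euclideanMetric (EuclideanSpace ℝ (Fin 6))).inducedRiemannianMetric f
    contMDiff_pullbackBilin_holds hf
  -- the integrand is continuous, nonnegative and integrable
  have h5 : Continuous fun z : EuclideanSpace ℝ (Fin 6) => z 5 :=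
    (EuclideanSpace.proj (5 : Fin 6) : EuclideanSpace ℝ (Fin 6) →L[ℝ] ℝ).continuous
  have hFc : Continuous fun w => 1 - νf w 5 ^ 2 :=
    continuous_const.sub ((h5.comp hνc).pow 2)
  have hFi : Integrable (fun w => 1 - νf w 5 ^ 2) (riemannianMeasure g₁) :=
    integrable_of_continuous (h := g₁) hFc
  -- `∫ F = 0` with `F ≥ 0` integrable: `F = 0` a.e.
  have hae : (fun w => 1 - νf w 5 ^ 2) =ᵐ[riemannianMeasure g₁] 0 :=
    (integral_eq_zero_iff_of_nonneg (fun w => one_sub_sq_apply_five_nonneg hun w) hFi).1 h0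
  -- the Riemannian measure charges nonempty open sets: a continuous a.e.-zero function is zero
  haveI : (riemannianMeasure g₁).IsOpenPosMeasure := isOpenPosMeasure_riemannianMeasure g₁
  have heq : (fun w => 1 - νf w 5 ^ 2) = 0 :=
    (hFc.ae_eq_iff_eq (riemannianMeasure g₁) continuous_const).1 hae
  exact congr_fun heq x

/-- **Registered helper `helper_horizontalOfTiltExcessZero` of line `killing-flux` (rigidity layer
R1-D).** For a closed immersed cross-section `f : M⁴ → ℝ⁶` with continuous unit normal `ν` and
induced metric `g = f^*δ`: if the tilt excess `∫_M (1 - ν₅²) dμ_g` vanishes, then `ν₅(x)² = 1` for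
every `x ∈ M` (`one_sub_sq_apply_five_eq_zero_of_tiltExcess_eq_zero`). [cite: Hamilton1993, §4] -/
theorem helper_horizontalOfTiltExcessZero :
    ∀ (M : Type) [TopologicalSpace M] [ChartedSpace (EuclideanSpace ℝ (Fin 4)) M]
      [IsManifold (𝓡 4) ∞ M] [CompactSpace M] [T2Space M] [MeasurableSpace M] [BorelSpace M]
      (f νf : M → EuclideanSpace ℝ (Fin 6))
      (hf : (Literature.Geometry.Riemannian.euclideanMetric
        (EuclideanSpace ℝ (Fin 6))).IsSpacelikeImmersion (𝓡 4) f),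
      Continuous νf →
      (Literature.Geometry.Riemannian.euclideanMetric
        (EuclideanSpace ℝ (Fin 6))).IsUnitNormal (𝓡 4) f νf 1 →
      ∫ w, (1 - νf w 5 ^ 2) ∂Literature.Geometry.Lorentzian.riemannianMeasure
        ((Literature.Geometry.Riemannian.euclideanMetric
          (EuclideanSpace ℝ (Fin 6))).inducedRiemannianMetric f
          Literature.Geometry.Lorentzian.PseudoRiemannianMetric.contMDiff_pullbackBilin_holds hf) = 0 →
      ∀ x, νf x 5 ^ 2 = 1 := by
  intro M _ _ _ _ _ _ _ f νf hf hνc hun h0 x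
  have h := one_sub_sq_apply_five_eq_zero_of_tiltExcess_eq_zero hf hνc hun h0 x
  linarith

end Summit.SmoothPoincare4.SmoothPoincare4.Cruxes.CylinderRungTwo.KillingFlux

end
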